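import Literature.AlgebraicGeometry.Motives.TateAbelianFiniteSteps
import Literature.AlgebraicGeometry.Motives.AbelianVarietyProduct
import HarnessLib

/-!
# Discharge of the named fact `AbelianVariety.hasBinaryBiproduct` (products of abelian varieties)

`Literature.AlgebraicGeometry.Motives.TateAbelianFiniteSteps` consumes products of abelian
varieties through the named fact
`Literature.AlgebraicGeometry.Motives.AbelianVariety.hasBinaryBiproduct A B : Prop :=
HasBinaryBiproduct A B` (Kieffer 2024, §1.1.1 p. 8 and §1.2.2 p. 22: `A × B` is an abelian
variety and `End(A × B) = End A ⊕ Hom(A, B) ⊕ Hom(B, A) ⊕ End B`), and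
`Literature.AlgebraicGeometry.Motives.AbelianVarietyProduct` — which is upstream of neither file's
other imports and downstream of `TateAbelianFiniteSteps` in no way — *constructs* the product
abelian variety `A ×_K B` (the group object `A.X ⊗ B.X` of the cartesian monoidal category
`Over (Spec K)`, proper and geometrically integral over `K`), proves that it is a binary product in
`AbelianVariety K` (`AbelianVariety.prodBinaryFanIsLimit`) and derives the instance
`HasBinaryBiproducts (AbelianVariety K)` (Mathlib `HasBinaryBiproducts.of_hasBinaryProducts` for
the preadditive structure). This file joins the two imports and records the discharge in the
form the consumers take (`(h : hasBinaryBiproduct A B)` fed `hasBinaryBiproduct_holds A B`):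

* `Literature.AlgebraicGeometry.Motives.AbelianVariety.hasBinaryBiproduct_holds A B` — the named
  fact holds for every pair of abelian varieties over any field;
* `Literature.AlgebraicGeometry.Motives.AbelianVariety.exists_binaryBicone_total_holds A B` — the
  hypothesis-free form of `exists_binaryBicone_total`: a bicone `b` on `(A, B)` with
  `b.fst ≫ b.inl + b.snd ≫ b.inr = 𝟙 b.pt`.

Everything here is proved; Mathlib has no bundled abelian varieties (only
`Mathlib/AlgebraicGeometry/Group/Abelian.lean`, commutativity of group schemes), all categorical
ingredients (`HasBinaryBiproduct`, `BinaryBiproduct.bicone`, `biprod.total`) are Mathlib's.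

## References

* [Kieffer2024IsogenyGraphs] J. Kieffer, *Isogeny graphs of abelian varieties over finite
  fields* (2024), §1.1.1 p. 8, §1.2.2 p. 22 (held).
* [Milne1986AbelianVarieties] J. S. Milne, *Abelian Varieties*, in Cornell–Silverman (eds.),
  *Arithmetic Geometry* (1986), Conventions p. 103 and §1 p. 104.
-/

noncomputable section

universe u

open CategoryTheory CategoryTheory.Limits

namespace Literature.AlgebraicGeometry.Motives

namespace AbelianVariety

variable {K : Type u} [Field K] (A B : AbelianVariety K)

/-- **Discharge of `hasBinaryBiproduct`.** Every pair of abelian varieties `A, B` over a field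
`K` has a biproduct in the preadditive category `Literature.AbelianVariety K`: the product abelian
variety `A ×_K B` (`AbelianVariety.prod`, `Motives/AbelianVarietyProduct`) with its projections
is a binary product (`AbelianVariety.prodBinaryFanIsLimit`), and a preadditive category with
binary products has binary biproducts (Mathlib `HasBinaryBiproducts.of_hasBinaryProducts`;
instance `AbelianVariety.hasBinaryBiproducts_inst`, theorem `AbelianVariety.hasBinaryBiproduct_inst`).
Kieffer 2024, §1.1.1 p. 8 ("if `A` and `B` are abelian varieties of any dimension, then `A × B`
is an abelian variety as well") and §1.2.2 p. 22; Milne 1986, Conventions p. 103 and §1 p. 104.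
[cite: Kieffer2024IsogenyGraphs, §1.1.1 p. 8 and §1.2.2 p. 22] -/
theorem hasBinaryBiproduct_holds : hasBinaryBiproduct A B :=
  (hasBinaryBiproduct_iff A B).2 (hasBinaryBiproduct_inst A B)

/-- A binary bicone on `(A, B)` with the total identity `fst ≫ inl + snd ≫ inr = 𝟙`, for every
pair of abelian varieties over a field — `exists_binaryBicone_total` fed the discharge
`hasBinaryBiproduct_holds` (Mathlib `BinaryBiproduct.bicone`, `biprod.total`). [folklore] -/
theorem exists_binaryBicone_total_holds :
    ∃ b : BinaryBicone A B, b.fst ≫ b.inl + b.snd ≫ b.inr = 𝟙 b.pt :=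
  exists_binaryBicone_total A B (hasBinaryBiproduct_holds A B)

end AbelianVariety

end Literature.AlgebraicGeometry.Motives
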